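import Summits.KontsevichZagierPeriods.KontsevichZagierPeriods.Theorems.SoloInformedNLPointCount
import HarnessLib
import HarnessLib.Audit

/-!
# SoloInformed — THEOREM NF: Newton–Leibniz elimination (file 4c-ii-d4, the assembly)

Solo programme `solo-KontsevichZagierPeriods-informed`, session s245 (K-NF, `paper/nl-elimination.md`
§2 and §7.2, FILE 4c-ii, assembly part 4 — the last file of the programme).

**THEOREM NF** (`soloInformed_nlElimination`).  Every Newton–Leibniz relation of the
Kontsevich–Zagier calculus is an *equidimensional* relation modulo *flattening*:
`newtonLeibnizRel ⊆ relations₁₂ ⊔ U`, where `relations₁₂ = soloInformedEquidimRelations` is the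
subgroup generated by the additivity and change-of-variables moves (files 584–589) and
`U = soloInformedFlatSpan` is generated by the differences `[r × [0,1]] − [r]`.

Proof (files 590–601 and this one).  For a Newton–Leibniz datum `Φ` (the frame of file 600) the
left side `[r]` is, modulo `relations₁₂`, a signed sum of *left sheets* (indicator representations
of the images of the signed open cells of an adapted `ℚ`-CAD under `(x, y) ↦ (x, F(x, y))`,
file 601), and the flattened right side `[r' × [0,1]]` is a signed sum of *right sheets* (images of
slabs under the shear `(x, t) ↦ (x, F(x, a x) + t g(x))`, file 601).  A second `ℚ`-CAD adapted to
all sheet domains and to the crossing graphs shows that at every point of each of its open cells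
the two signed multiplicities agree (file 4c-ii-d3, LEMMA C), so KEY LEMMA (K) (file 596) puts the
difference of the two signed sums in `relations₁₂` (`SoloInformedNLFrame.sheets_mem`).  Hence
`[r] − [r' × [0,1]] ∈ relations₁₂` (`SoloInformedNLFrame.main`) and
`[r] − [r'] ∈ relations₁₂ ⊔ U`.

Corollaries (now unconditional): `relations = relations₁₂ ⊔ U` (`soloInformed_relations_eq_sup`)
and KZ-equivalence of two representations is membership of their difference in `relations₁₂ ⊔ U`
(`soloInformed_equivalent_iff_mem_sup`).

References: this work (THEOREM NF, `paper/nl-elimination.md` §2); [Kontsevich–Zagier 2001, §1.2]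
for the calculus.
-/

noncomputable section

open scoped BigOperators Topology ContDiff

namespace Summit.KontsevichZagierPeriods.KontsevichZagierPeriods.Theorems

open Set MeasureTheory Filter
open Literature.ModelTheory.ExponentialFields
open Literature.NumberTheory.Transcendental Literature.NumberTheory.Transcendental.KZ

variable {n : ℕ}

namespace SoloInformedNLFrame

variable (Φ : SoloInformedNLFrame n)

/-- Base cells are nonempty. -/
theorem base_nonempty {S : Set (Fin n → ℝ)} (hS : S ∈ Φ.𝒮) : S.Nonempty :=
  Set.nonempty_iff_ne_empty.2 fun h => Φ.hpartS.1 (by rw [← h]; exact Finset.mem_coe.2 hS)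

/-- Membership in `Sτ`. -/
theorem mem_Sτ {S : Set (Fin n → ℝ)} : S ∈ Φ.Sτ ↔ S ∈ Φ.𝒮 ∧ S ⊆ Φ.r'.domain := by
  classical
  rw [Sτ, Finset.mem_filter]

/-- The lower crossing graph of a band inside `B` is semialgebraic. -/
theorem isSemialgebraic_crossLoGraph {p : Σ S : Set (Fin n → ℝ), Fin (Φ.lS S + 1)}
    (hp : p ∈ Φ.𝒮.sigma Φ.JB) :
    IsSemialgebraic ℚ (graphOver p.1
      (fun x => Φ.F (Fin.snoc x (bandLower (Φ.ξ p.1) p.2 x).toReal))) := by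
  obtain ⟨hS, hj⟩ := Finset.mem_sigma.1 hp
  have hB := Φ.mem_JB.1 hj
  obtain ⟨x, hx⟩ := Φ.base_nonempty hS
  have h0 := (soloInformed_bounds_of_band_subset Φ.hmono hS hx (Φ.band_subset_iff'.1 hB)).fst
  rw [Φ.crossLo_eq h0]
  exact isSemialgebraicFunOn_iff_isSemialgebraic_graphOver.1 (Φ.isSemialgebraicFunOn_crossLo hS hB h0)

/-- The upper crossing graph of a band inside `B` is semialgebraic. -/
theorem isSemialgebraic_crossHiGraph {p : Σ S : Set (Fin n → ℝ), Fin (Φ.lS S + 1)}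
    (hp : p ∈ Φ.𝒮.sigma Φ.JB) :
    IsSemialgebraic ℚ (graphOver p.1
      (fun x => Φ.F (Fin.snoc x (bandUpper (Φ.ξ p.1) p.2 x).toReal))) := by
  obtain ⟨hS, hj⟩ := Finset.mem_sigma.1 hp
  have hB := Φ.mem_JB.1 hj
  obtain ⟨x, hx⟩ := Φ.base_nonempty hS
  have hl := (soloInformed_bounds_of_band_subset Φ.hmono hS hx (Φ.band_subset_iff'.1 hB)).snd.fst
  rw [Φ.crossHi_eq hl]
  exact isSemialgebraicFunOn_iff_isSemialgebraic_graphOver.1 (Φ.isSemialgebraicFunOn_crossHi hS hB hl)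

/-- The graph of `F(·, a ·)` over a base cell inside `τ` is semialgebraic. -/
theorem isSemialgebraic_aGraph {S : Set (Fin n → ℝ)} (hS : S ∈ Φ.Sτ) :
    IsSemialgebraic ℚ (graphOver S (fun x => Φ.F (Fin.snoc x (Φ.a x)))) :=
  isSemialgebraicFunOn_iff_isSemialgebraic_graphOver.1 (Φ.isSemialgebraicFunOn_ha.mono
    (Φ.mem_Sτ.1 hS).2 (Φ.h𝒮.isSemialgebraic S (Φ.mem_Sτ.1 hS).1))

/-- The graph of `F(·, b ·)` over a base cell inside `τ` is semialgebraic. -/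
theorem isSemialgebraic_bGraph {S : Set (Fin n → ℝ)} (hS : S ∈ Φ.Sτ) :
    IsSemialgebraic ℚ (graphOver S (fun x => Φ.F (Fin.snoc x (Φ.b x)))) :=
  isSemialgebraicFunOn_iff_isSemialgebraic_graphOver.1 (Φ.isSemialgebraicFunOn_hb.mono
    (Φ.mem_Sτ.1 hS).2 (Φ.h𝒮.isSemialgebraic S (Φ.mem_Sτ.1 hS).1))

open Classical in
/-- The family of sets the second decomposition is adapted to: all sheet domains, the crossing
graphs of the sections bounding the bands inside `B`, and the graphs of `F(·, a ·)`, `F(·, b ·)`. -/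
def fam : Finset (Set (Fin (n + 1) → ℝ)) :=
  (Φ.IL.disjSum Φ.IR).image (fun i => (Sum.elim Φ.lSheet Φ.rSheet i).domain) ∪
    (Φ.𝒮.sigma Φ.JB).image (fun p =>
      graphOver p.1 (fun x => Φ.F (Fin.snoc x (bandLower (Φ.ξ p.1) p.2 x).toReal))) ∪
    (Φ.𝒮.sigma Φ.JB).image (fun p =>
      graphOver p.1 (fun x => Φ.F (Fin.snoc x (bandUpper (Φ.ξ p.1) p.2 x).toReal))) ∪
    Φ.Sτ.image (fun S => graphOver S (fun x => Φ.F (Fin.snoc x (Φ.a x)))) ∪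
    Φ.Sτ.image (fun S => graphOver S (fun x => Φ.F (Fin.snoc x (Φ.b x))))

/-- Every member of the family is semialgebraic over `ℚ`. -/
theorem fam_isSemialgebraic : ∀ s ∈ Φ.fam, IsSemialgebraic ℚ s := by
  classical
  intro s hs
  simp only [fam, Finset.mem_union, Finset.mem_image] at hs
  rcases hs with (((⟨i, -, rfl⟩ | ⟨p, hp, rfl⟩) | ⟨p, hp, rfl⟩) | ⟨S, hS, rfl⟩) | ⟨S, hS, rfl⟩
  · exact (Sum.elim Φ.lSheet Φ.rSheet i).isSemialgebraic_domain
  · exact Φ.isSemialgebraic_crossLoGraph hp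
  · exact Φ.isSemialgebraic_crossHiGraph hp
  · exact Φ.isSemialgebraic_aGraph hS
  · exact Φ.isSemialgebraic_bGraph hS

/-- Sheet domains belong to the family. -/
theorem dom_mem_fam {i : (Σ S : Set (Fin n → ℝ), Fin (Φ.lS S + 1)) ⊕ Set (Fin n → ℝ)}
    (hi : i ∈ Φ.IL.disjSum Φ.IR) : (Sum.elim Φ.lSheet Φ.rSheet i).domain ∈ Φ.fam := by
  classical
  rw [fam]
  exact Finset.mem_union_left _ (Finset.mem_union_left _ (Finset.mem_union_left _
    (Finset.mem_union_left _ (Finset.mem_image_of_mem _ hi))))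

/-- Lower crossing graphs belong to the family. -/
theorem lo_mem_fam {p : Σ S : Set (Fin n → ℝ), Fin (Φ.lS S + 1)} (hp : p ∈ Φ.𝒮.sigma Φ.JB) :
    graphOver p.1 (fun x => Φ.F (Fin.snoc x (bandLower (Φ.ξ p.1) p.2 x).toReal)) ∈ Φ.fam := by
  classical
  rw [fam]
  exact Finset.mem_union_left _ (Finset.mem_union_left _ (Finset.mem_union_left _
    (Finset.mem_union_right _ (Finset.mem_image_of_mem _ hp))))

/-- Upper crossing graphs belong to the family. -/
theorem hi_mem_fam {p : Σ S : Set (Fin n → ℝ), Fin (Φ.lS S + 1)} (hp : p ∈ Φ.𝒮.sigma Φ.JB) :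
    graphOver p.1 (fun x => Φ.F (Fin.snoc x (bandUpper (Φ.ξ p.1) p.2 x).toReal)) ∈ Φ.fam := by
  classical
  rw [fam]
  exact Finset.mem_union_left _ (Finset.mem_union_left _
    (Finset.mem_union_right _ (Finset.mem_image_of_mem _ hp)))

/-- The graphs of `F(·, a ·)` belong to the family. -/
theorem a_mem_fam {S : Set (Fin n → ℝ)} (hS : S ∈ Φ.Sτ) :
    graphOver S (fun x => Φ.F (Fin.snoc x (Φ.a x))) ∈ Φ.fam := by
  classical
  rw [fam]
  exact Finset.mem_union_left _ (Finset.mem_union_right _ (Finset.mem_image_of_mem _ hS))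

/-- The graphs of `F(·, b ·)` belong to the family. -/
theorem b_mem_fam {S : Set (Fin n → ℝ)} (hS : S ∈ Φ.Sτ) :
    graphOver S (fun x => Φ.F (Fin.snoc x (Φ.b x))) ∈ Φ.fam := by
  classical
  rw [fam]
  exact Finset.mem_union_right _ (Finset.mem_image_of_mem _ hS)

/-- All sheets have integrand `1`. -/
theorem sheet_integrand :
    ∀ i ∈ Φ.IL.disjSum Φ.IR, (Sum.elim Φ.lSheet Φ.rSheet i).integrand = fun _ => 1 := by
  rintro (p | S) hi
  · have hp := Finset.inl_mem_disjSum.1 hi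
    obtain ⟨-, -, hPN⟩ := Φ.mem_IL.1 hp
    exact Φ.lSheet_integrand (Φ.lCond_of_mem_IL hp) hPN
  · obtain ⟨⟨hS, hSτ⟩, hSo, hpm⟩ := Φ.mem_IR.1 (Finset.inr_mem_disjSum.1 hi)
    exact Φ.rSheet_integrand ⟨hS, hSo, hSτ⟩ hpm

open Classical in
/-- **The sheets cancel**: the signed sum of the left sheets minus the signed sum of the right
sheets lies in `relations₁₂` (KEY LEMMA (K) on a second adapted `ℚ`-CAD, with LEMMA C). -/
theorem sheets_mem :
    ∑ p ∈ Φ.IL, Φ.εL p • of (Φ.lSheet p) - ∑ S ∈ Φ.IR, Φ.εR S • of (Φ.rSheet S) ∈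
      soloInformedEquidimRelations := by
  obtain ⟨𝒯', h𝒯', had⟩ :=
    IsSemialgebraic.exists_cylindricalDecomposition_holds (k := ℚ) Φ.fam Φ.fam_isSemialgebraic
  have hlo : ∀ p ∈ Φ.𝒮.sigma Φ.JB, ∃ 𝒞, 𝒞 ⊆ 𝒯' ∧ ⋃₀ (𝒞 : Set (Set (Fin (n + 1) → ℝ))) =
      graphOver p.1 (fun x => Φ.F (Fin.snoc x (bandLower (Φ.ξ p.1) p.2 x).toReal)) :=
    fun p hp => had _ (Φ.lo_mem_fam hp)
  have hhi : ∀ p ∈ Φ.𝒮.sigma Φ.JB, ∃ 𝒞, 𝒞 ⊆ 𝒯' ∧ ⋃₀ (𝒞 : Set (Set (Fin (n + 1) → ℝ))) =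
      graphOver p.1 (fun x => Φ.F (Fin.snoc x (bandUpper (Φ.ξ p.1) p.2 x).toReal)) :=
    fun p hp => had _ (Φ.hi_mem_fam hp)
  have ha : ∀ S ∈ Φ.Sτ, ∃ 𝒞, 𝒞 ⊆ 𝒯' ∧ ⋃₀ (𝒞 : Set (Set (Fin (n + 1) → ℝ))) =
      graphOver S (fun x => Φ.F (Fin.snoc x (Φ.a x))) := fun S hS => had _ (Φ.a_mem_fam hS)
  have hb : ∀ S ∈ Φ.Sτ, ∃ 𝒞, 𝒞 ⊆ 𝒯' ∧ ⋃₀ (𝒞 : Set (Set (Fin (n + 1) → ℝ))) =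
      graphOver S (fun x => Φ.F (Fin.snoc x (Φ.b x))) := fun S hS => had _ (Φ.b_mem_fam hS)
  choose 𝒞f h𝒞f hUf using had
  have h𝒞' : ∀ i ∈ Φ.IL.disjSum Φ.IR,
      (if h : (Sum.elim Φ.lSheet Φ.rSheet i).domain ∈ Φ.fam then 𝒞f _ h else ∅) ⊆ 𝒯' := by
    intro i hi
    rw [dif_pos (Φ.dom_mem_fam hi)]
    exact h𝒞f _ _
  have hU' : ∀ i ∈ Φ.IL.disjSum Φ.IR,
      ⋃₀ ((if h : (Sum.elim Φ.lSheet Φ.rSheet i).domain ∈ Φ.fam then 𝒞f _ h else ∅ :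
        Finset (Set (Fin (n + 1) → ℝ))) : Set (Set (Fin (n + 1) → ℝ))) =
        (Sum.elim Φ.lSheet Φ.rSheet i).domain := by
    intro i hi
    rw [dif_pos (Φ.dom_mem_fam hi)]
    exact hUf _ _
  have key : ∑ i ∈ Φ.IL.disjSum Φ.IR,
      Sum.elim Φ.εL (fun S => -Φ.εR S) i • of (Sum.elim Φ.lSheet Φ.rSheet i) ∈
        soloInformedEquidimRelations := by
    refine soloInformed_sum_smul_of_mem_of_multiplicity_eq_zero h𝒯' (Φ.IL.disjSum Φ.IR)
      (Sum.elim Φ.lSheet Φ.rSheet) (Sum.elim Φ.εL fun S => -Φ.εR S) Φ.sheet_integrand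
      (fun i => if h : (Sum.elim Φ.lSheet Φ.rSheet i).domain ∈ Φ.fam then 𝒞f _ h else ∅)
      h𝒞' hU' fun D hD hDo => ?_
    -- the signed multiplicity on the open cell `D ∋ w` vanishes
    have hDne : D.Nonempty := Set.nonempty_iff_ne_empty.2 fun h =>
      h𝒯'.isPartition.1 (by rw [← h]; exact Finset.mem_coe.2 hD)
    obtain ⟨w, hw⟩ := hDne
    have hiff : ∀ i ∈ Φ.IL.disjSum Φ.IR, (D ⊆ (Sum.elim Φ.lSheet Φ.rSheet i).domain ↔
        w ∈ (Sum.elim Φ.lSheet Φ.rSheet i).domain) :=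
      fun i hi => soloInformed_cell_subset_iff_mem_pt h𝒯'.isPartition (h𝒞' i hi) (hU' i hi) hD hw
    have hL' : ∀ p ∈ Φ.IL,
        (if D ⊆ (Sum.elim Φ.lSheet Φ.rSheet (Sum.inl p)).domain then
          Sum.elim Φ.εL (fun S => -Φ.εR S) (Sum.inl p) else 0) =
        Φ.εL p * (if w ∈ (Φ.lSheet p).domain then 1 else 0) := by
      intro p hp
      have h := hiff (Sum.inl p) (Finset.inl_mem_disjSum.2 hp)
      simp only [Sum.elim_inl] at h
      show (if D ⊆ (Φ.lSheet p).domain then Φ.εL p else 0) =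
        Φ.εL p * (if w ∈ (Φ.lSheet p).domain then 1 else 0)
      by_cases hsub : D ⊆ (Φ.lSheet p).domain
      · rw [if_pos hsub, if_pos (h.1 hsub), mul_one]
      · rw [if_neg hsub, if_neg (fun h' => hsub (h.2 h')), mul_zero]
    have hR' : ∀ S ∈ Φ.IR,
        (if D ⊆ (Sum.elim Φ.lSheet Φ.rSheet (Sum.inr S)).domain then
          Sum.elim Φ.εL (fun S => -Φ.εR S) (Sum.inr S) else 0) =
        -(Φ.εR S * (if w ∈ (Φ.rSheet S).domain then 1 else 0)) := by
      intro S hS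
      have h := hiff (Sum.inr S) (Finset.inr_mem_disjSum.2 hS)
      simp only [Sum.elim_inr] at h
      show (if D ⊆ (Φ.rSheet S).domain then -Φ.εR S else 0) =
        -(Φ.εR S * (if w ∈ (Φ.rSheet S).domain then 1 else 0))
      by_cases hsub : D ⊆ (Φ.rSheet S).domain
      · rw [if_pos hsub, if_pos (h.1 hsub), mul_one]
      · rw [if_neg hsub, if_neg (fun h' => hsub (h.2 h')), mul_zero, neg_zero]
    rw [Finset.sum_filter, Finset.sum_disjSum]
    exact (congrArg₂ (· + ·) (Finset.sum_congr rfl hL') (Finset.sum_congr rfl hR')).trans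
      (by rw [Finset.sum_neg_distrib, Φ.multiplicity_eq h𝒯' hlo hhi ha hb hD hDo hw, add_neg_cancel])
  rw [Finset.sum_disjSum] at key
  simpa only [Sum.elim_inl, Sum.elim_inr, neg_smul, Finset.sum_neg_distrib, ← sub_eq_add_neg]
    using key

/-- **`[r] − [r' × [0,1]] ∈ relations₁₂`** for every Newton–Leibniz datum. -/
theorem main : of Φ.r - of (soloInformedFlat Φ.r') ∈ soloInformedEquidimRelations := by
  have h := sub_mem (add_mem Φ.lhs_mem Φ.sheets_mem) Φ.rhs_mem
  convert h using 1
  abel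

end SoloInformedNLFrame

/-- **THEOREM NF (Newton–Leibniz elimination).**  Every Newton–Leibniz relation of the
Kontsevich–Zagier calculus is an equidimensional relation modulo flattening:
`newtonLeibnizRel ⊆ relations₁₂ ⊔ U`.  [this work, THEOREM NF] -/
theorem soloInformed_nlElimination : SoloInformedNLElimination := by
  intro c hc
  obtain ⟨n, r, r', a, b, F, hF, ha, hb, hab, hdom, hcont, hderiv, hr', rfl⟩ := hc
  obtain ⟨Φ, hr, hr'Φ⟩ := soloInformed_exists_frame r r' a b F hF ha hb hab hdom hcont hderiv hr'
  have h1 : of Φ.r - of (soloInformedFlat Φ.r') ∈ soloInformedEquidimRelations := Φ.main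
  rw [hr, hr'Φ] at h1
  have h2 : of (soloInformedFlat r') - of r' ∈ soloInformedFlatSpan :=
    AddSubgroup.subset_closure ⟨n, r', rfl⟩
  have h3 := (soloInformedEquidimRelations ⊔ soloInformedFlatSpan).add_mem
    (AddSubgroup.mem_sup_left h1) (AddSubgroup.mem_sup_right h2)
  rwa [sub_add_sub_cancel] at h3

/-- **`relations = relations₁₂ ⊔ U`**: the relations of the Kontsevich–Zagier calculus are the
equidimensional relations plus flattening.  [this work, THEOREM NF] -/
theorem soloInformed_relations_eq_sup :
    relations = soloInformedEquidimRelations ⊔ soloInformedFlatSpan :=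
  soloInformed_relations_eq_sup_of_nlElimination soloInformed_nlElimination

/-- Two representations are KZ-equivalent iff `[r] − [r'] ∈ relations₁₂ ⊔ U`.
[this work, THEOREM NF] -/
theorem soloInformed_equivalent_iff_mem_sup {m : ℕ} (r : IntegralRep n) (r' : IntegralRep m) :
    Equivalent r r' ↔ of r - of r' ∈ soloInformedEquidimRelations ⊔ soloInformedFlatSpan :=
  soloInformed_equivalent_iff_of_nlElimination soloInformed_nlElimination r r'

end Summit.KontsevichZagierPeriods.KontsevichZagierPeriods.Theorems
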